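/-
Copyright (c) 2026 the pub-hodgecm-mathlib formalisation cell (harness21).  Prover seat hodgecm-mathlib-LH4-p18 (g3), Track A «FOUR-FRAME» hand on VALVE loan to
Track B «K2-LIT», #184♮ = hLiu418 = `stmt-HodgeConjecture-24832`; socket #41, KIND 1 (K1-b♮), organ (K1b-W) ∕ (ρ·), brick (P-supp-lat) sub-brick (lat-a) —
LEAD F0P6-plan (g14) BATCH #165 (2), desk K2Liu-p14 (g4) DESK WORD #5 (5) ∕ #6 («=» on the three-file cut 2026-09-04T23:58:05Z).
THEOREMS ONLY (no `def`, no `instance`, no notation, no named-fact hypothesis, no `sorry`).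
-/
import Literature.NumberTheory.GelbartRogawski1991.LocalDoubledUnitaryUnramifiedCell   -- ★ `nElem`, `matA_ofAdapted`, `isIntegralAt_cayR∕cayRinv`, `isIntegralAt_matA_nElem`, `nElem_inv`, `IsIntegralAt`
import Literature.NumberTheory.Automorphic.GLnCongruenceSubgroups                       -- ★ `congruenceGL`, `mem_congruenceGL_iff`, `ValBound.mul∕add∕neg∕mono`
import HarnessLib

/-!
# Crux `HLiu418`, socket #41, (P-supp-lat) sub-brick (lat-a) — `K2LiuUnipotentDeepLevel`: DEEP UNIPOTENTS ARE DEEP —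
# `n(t)_w ∈ K_w(γ) = congruenceGL (n+n) γ` whenever the skew block `t` has `w`-entries of valuation `≤ γ ≤ 1` (and `|2|_w = 1`)

Cell `hodgecm-mathlib`, crux item hLiu418 = `stmt-HodgeConjecture-24832` (helper lane `--supports … --as helper`, count-neutral), route of record `HCCMUnconditional`;
squad K2 ∕ K2Liu (L1, LEAD F0P6-plan (g14)), road `K2_Liu`, socket #41, KIND 1, organ (K1b-W) ∕ (ρ·) (desk K2Liu-p14 (g4)), brick (P-supp-lat) — the payer of the
engine's by-value letter `hlatU` (★-cand `K2LiuKindOneLineTermEngine`, DESK WORD #6 (b)): «`ψ_S ≡ 1` on the unipotents `b` with `(h⁻¹ b h)_f ∈ U` ⟹ the per-place lattice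
letter `hloc` of ★ `hsupp_of_local`».  Its TEST ELEMENTS are the place inclusions `b = ι_v n(X)` of LOCAL unipotents `n(X)` (★ `nElem`) with DEEP skew blocks `X`; to put
`(h⁻¹ b h)_w` into the level `K_w(ϖ^{m_w})` of `U` (📤 (ρ5) `K2LiuOpenSubgroupCongruenceLevel`) by ★ (c1) `conj_mem_congruenceGL_of_localHeight_le` one needs
`n(X)_w ∈ K_w(ϖ^{m_w + 2a_w})` — THIS FILE, generic rank `n`, GR91 local frame `(F, E, c, v, n, T₀, JD)` of ★ `LocalDoubledUnitaryUnramifiedCell`: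
* §1 `valBound_map_mul` — `ValBound` of `w`-components is submultiplicative (`(M N).map ev_w = (M.map ev_w)(N.map ev_w)`, ★ `ValBound.mul`).
* §2 **`valBound_matA_nElem_sub_one`** — `matA (n(t)) − 1 = R · [[0, t], [0, 0]] · R⁻¹` (★ `matA_ofAdapted`, `R R⁻¹ = 1`), so its `w`-entries are bounded by those of `t` when
  `|2|_w = 1` (★ `isIntegralAt_cayR`, `isIntegralAt_cayRinv`).
* §3 `apply_mem_congruenceGL_of_valBound` — the component dictionary: `(k)_w ∈ congruenceGL (n+n) γ` from `IsIntegralAt (matA k)`, `IsIntegralAt (matA k⁻¹)` and the two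
  `ValBound γ ((matA k±¹ − 1).map ev_w)` (★ `coe_component_eq_matS_map`, ★ `reindex_matA`, exactly as ★ `apply_mem_glInt_of_isIntegralAt`).
* §4 HEAD **`nElem_apply_mem_congruenceGL`** — `|2|_w = 1`, `γ ≤ 1`, `ValBound γ (t.map ev_w)` ⟹ `(n(t))_w ∈ congruenceGL (n+n) γ` (inverse = `n(−t)`, ★ `nElem_inv`); and the
  uniformizer reading `nElem_apply_mem_congruenceGL_pow` at `γ := valuation ϖ_w ^ M`.
* §5 (ED. 2, appended) **`nElem_apply_mem_congruenceGL_of_two`** ∕ `…_pow_of_two` — EVERY place, dyadic included: `ValBound (|2|_w · γ) (t.map ev_w)` ⟹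
  `(n(t))_w ∈ congruenceGL (n+n) γ` (`|R⁻¹| ≤ |2|_w⁻¹`, `valBound_cayRinv`; integrality from `≡ 1 (γ)`, `isIntegralAt_of_valBound_sub_one`).
[PlatonovRapinchuk1994, §5.1] [GelbartRogawski1991, §3.1 (3.1.3)] [HarrisKudlaSweet1996, §1 (1.11)] [Casselman1980, §3].
HONEST LABEL.  Count-neutral helper, closes no socket: `HC_CM` is proved only modulo the 7 printed citations (2 remaining named inputs: hLiu418 = `stmt-HodgeConjecture-24832`,
h413 = `stmt-HodgeConjecture-24833`) until rung 0 closes.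

## References
* [PlatonovRapinchuk1994] V. Platonov, A. Rapinchuk, *Algebraic Groups and Number Theory* (1994): §5.1 (principal congruence subgroups of `G(𝒪_v)`).
* [GelbartRogawski1991] S. Gelbart, J. Rogawski, Invent. Math. 105 (1991): §3.1 (3.1.3) (the integral structure of the doubled unitary group).
* [HarrisKudlaSweet1996] M. Harris, S. Kudla, W. J. Sweet, J. AMS 9 (1996): §1 (1.11) (the Cayley frame `R`, `R⁻¹ = ½R`).
* [Casselman1980] W. Casselman, Compositio Math. 40 (1980): §3 (deep unipotent elements act trivially on vectors of deep level).
-/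

set_option autoImplicit false
set_option linter.dupNamespace false -- the mandated namespace repeats `HodgeConjecture.HodgeConjecture`

noncomputable section

open NumberField IsDedekindDomain Matrix
open scoped ValuativeRel MatrixGroups
open Literature.NumberTheory.Automorphic Literature.NumberTheory.Automorphic.UnitaryGroup
open Literature.NumberTheory.GelbartRogawski1991 Literature.NumberTheory.GelbartRogawski1991.AdaptedBlocks
open Literature.NumberTheory.GelbartRogawski1991.UnitaryDualPair Literature.NumberTheory.GelbartRogawski1991.UnitaryDualPair.LocalSplitting

namespace Summit.HodgeConjecture.HodgeConjecture.Cruxes.HLiu418.K2LiuUnipotentDeepLevel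

variable (F : Type) [Field F] [NumberField F] (E : Type) [Field E] [NumberField E] [Algebra F E]
  [Algebra.IsQuadraticExtension F E] (c : E ≃ₐ[F] E)
  (v : HeightOneSpectrum (𝓞 F)) (n : ℕ) {T₀ : Matrix (Fin n) (Fin n) F}
  {JD : Matrix (Fin (n + n)) (Fin (n + n)) E} (hJD : JD = (gramD F n T₀).map (algebraMap F E))

/-! ## §1 `ValBound` of `w`-components is submultiplicative -/

section ValBoundMap

variable {F E v} {m : Type*} [Fintype m] [DecidableEq m] {w : PlacesOver E v}

omit [NumberField F] [Algebra.IsQuadraticExtension F E] [DecidableEq m] in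
/-- `(M N)_w = M_w N_w`, so `ValBound` of `w`-components is submultiplicative (★ `ValBound.mul`). [folklore] -/
theorem valBound_map_mul {γ₁ γ₂ : ValuativeRel.ValueGroupWithZero (w.1.adicCompletion E)} {M N : Matrix m m (LocalRing E v)}
    (hM : ValBound γ₁ (M.map (Pi.evalRingHom (fun w' : PlacesOver E v => w'.1.adicCompletion E) w)))
    (hN : ValBound γ₂ (N.map (Pi.evalRingHom (fun w' : PlacesOver E v => w'.1.adicCompletion E) w))) :
    ValBound (γ₁ * γ₂) ((M * N).map (Pi.evalRingHom (fun w' : PlacesOver E v => w'.1.adicCompletion E) w)) := by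
  rw [Matrix.map_mul]
  exact hM.mul hN

end ValBoundMap

/-! ## §2 The adapted frame: `matA (n(t)) − 1 = R · [[0, t], [0, 0]] · R⁻¹` has `w`-entries bounded by those of `t` -/

section Adapted

variable {w : PlacesOver E v}

omit [Algebra.IsQuadraticExtension F E] in
include hJD in
/-- **`matA (n(t)) − 1 = R · (fromBlocks 0 t 0 0) · R⁻¹`** (★ `matA_ofAdapted`: `matA (n(t)) = R · [[1,t],[0,1]] · R⁻¹`, and `R · 1 · R⁻¹ = 1`). [cite: HarrisKudlaSweet1996, §1 (1.11)] -/
theorem matA_nElem_sub_one {t : Matrix (Fin n) (Fin n) (LocalRing E v)}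
    (ht : (t.map (conjLocal E c v))ᵀ * gramS F E v n T₀ + gramS F E v n T₀ * t = 0) :
    matA F E c v n (nElem F E c v n hJD t ht) - 1 =
      cayR (LocalRing E v) (Fin n) * Matrix.fromBlocks 0 t 0 0 * cayRinv (LocalRing E v) (Fin n) := by
  rw [nElem, matA_ofAdapted]
  have h1 : (Matrix.fromBlocks 1 t 0 1 : Matrix (Fin n ⊕ Fin n) (Fin n ⊕ Fin n) (LocalRing E v)) = 1 + Matrix.fromBlocks 0 t 0 0 := by
    rw [← Matrix.fromBlocks_one, Matrix.fromBlocks_add]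
    simp
  rw [h1, Matrix.mul_add, Matrix.add_mul, Matrix.mul_one, cayR_mul_cayRinv, add_sub_cancel_left]

omit [NumberField F] [Algebra.IsQuadraticExtension F E] in
/-- the `w`-entries of `fromBlocks 0 t 0 0` are bounded by those of `t`. [folklore] -/
theorem valBound_fromBlocks_zero {γ : ValuativeRel.ValueGroupWithZero (w.1.adicCompletion E)} {t : Matrix (Fin n) (Fin n) (LocalRing E v)}
    (htγ : ValBound γ (t.map (Pi.evalRingHom (fun w' : PlacesOver E v => w'.1.adicCompletion E) w))) :
    ValBound γ ((Matrix.fromBlocks 0 t 0 0 : Matrix (Fin n ⊕ Fin n) (Fin n ⊕ Fin n) (LocalRing E v)).map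
      (Pi.evalRingHom (fun w' : PlacesOver E v => w'.1.adicCompletion E) w)) := by
  rintro (i | i) (j | j)
  · simp
  · exact htγ i j
  · simp
  · simp

omit [Algebra.IsQuadraticExtension F E] in
include hJD in
/-- **THE `w`-ENTRIES OF `matA (n(t)) − 1` ARE BOUNDED BY THOSE OF `t`** (`|2|_w = 1`: `R`, `R⁻¹ = ½R` are `w`-integral, ★ `isIntegralAt_cayR`, ★ `isIntegralAt_cayRinv`).
[cite: HarrisKudlaSweet1996, §1 (1.11)] [cite: PlatonovRapinchuk1994, §5.1] -/
theorem valBound_matA_nElem_sub_one (h2 : ValuativeRel.valuation (w.1.adicCompletion E) (2 : w.1.adicCompletion E) = 1)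
    {t : Matrix (Fin n) (Fin n) (LocalRing E v)} (ht : (t.map (conjLocal E c v))ᵀ * gramS F E v n T₀ + gramS F E v n T₀ * t = 0)
    {γ : ValuativeRel.ValueGroupWithZero (w.1.adicCompletion E)} (htγ : ValBound γ (t.map (Pi.evalRingHom (fun w' : PlacesOver E v => w'.1.adicCompletion E) w))) :
    ValBound γ ((matA F E c v n (nElem F E c v n hJD t ht) - 1).map (Pi.evalRingHom (fun w' : PlacesOver E v => w'.1.adicCompletion E) w)) := by
  rw [matA_nElem_sub_one F E c v n hJD ht]
  have hR : ValBound 1 ((cayR (LocalRing E v) (Fin n)).map (Pi.evalRingHom (fun w' : PlacesOver E v => w'.1.adicCompletion E) w)) :=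
    isIntegralAt_cayR F E v n w
  have hRi : ValBound 1 ((cayRinv (LocalRing E v) (Fin n)).map (Pi.evalRingHom (fun w' : PlacesOver E v => w'.1.adicCompletion E) w)) :=
    isIntegralAt_cayRinv F E v n w h2
  have h : ValBound (1 * γ * 1) ((cayR (LocalRing E v) (Fin n) * Matrix.fromBlocks 0 t 0 0 * cayRinv (LocalRing E v) (Fin n)).map
      (Pi.evalRingHom (fun w' : PlacesOver E v => w'.1.adicCompletion E) w)) :=
    valBound_map_mul (valBound_map_mul hR (valBound_fromBlocks_zero F E v n htγ)) hRi
  rwa [one_mul, mul_one] at h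

end Adapted

/-! ## §3 The component dictionary: from the matrix over `E ⊗ F_v` to the `w`-component in `GL_{n+n}(E_w)` -/

section Component

variable {w : PlacesOver E v}

omit [Algebra.IsQuadraticExtension F E] in
/-- **`(k)_w ∈ congruenceGL (n+n) γ`** from the four letters on the matrix `matA k` over `E ⊗ F_v`: integrality of `matA k` and `matA k⁻¹` at `w`, and `ValBound γ` of the
`w`-components of `matA k − 1` and `matA k⁻¹ − 1` (the `w`-component matrix of `k` is the `e₂`-re-enumeration of `(matA k)_w`, ★ `coe_component_eq_matS_map` + ★ `reindex_matA`).
[cite: PlatonovRapinchuk1994, §5.1] -/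
theorem apply_mem_congruenceGL_of_valBound (k : UnitaryGroup.localPi E c (n + n) JD v) (γ : ValuativeRel.ValueGroupWithZero (w.1.adicCompletion E))
    (hk : IsIntegralAt F E v w (matA F E c v n k)) (hk' : IsIntegralAt F E v w (matA F E c v n k⁻¹))
    (hk1 : ValBound γ ((matA F E c v n k - 1).map (Pi.evalRingHom (fun w' : PlacesOver E v => w'.1.adicCompletion E) w)))
    (hk1' : ValBound γ ((matA F E c v n k⁻¹ - 1).map (Pi.evalRingHom (fun w' : PlacesOver E v => w'.1.adicCompletion E) w))) :
    (k : UnitaryGroup.LocalGLPi E (n + n) v) w ∈ congruenceGL (n + n) γ := by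
  rw [mem_congruenceGL_iff]
  have e : ∀ g : UnitaryGroup.localPi E c (n + n) JD v,
      (((g : UnitaryGroup.LocalGLPi E (n + n) v) w : GL (Fin (n + n)) (w.1.adicCompletion E)) :
        Matrix (Fin (n + n)) (Fin (n + n)) (w.1.adicCompletion E)) =
        ((matA F E c v n g).submatrix (e₂ n).symm (e₂ n).symm).map (Pi.evalRingHom _ w) := by
    intro g
    rw [coe_component_eq_matS_map, ← reindex_matA, Matrix.reindex_apply]
  have hinv : ((k : UnitaryGroup.LocalGLPi E (n + n) v) w)⁻¹ = ((k⁻¹ : UnitaryGroup.localPi E c (n + n) JD v) : UnitaryGroup.LocalGLPi E (n + n) v) w := by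
    rw [Subgroup.coe_inv, Pi.inv_apply]
  have hsub1 : ∀ g : UnitaryGroup.localPi E c (n + n) JD v,
      ((matA F E c v n g - 1).submatrix (e₂ n).symm (e₂ n).symm).map (Pi.evalRingHom (fun w' : PlacesOver E v => w'.1.adicCompletion E) w) =
        ((matA F E c v n g).submatrix (e₂ n).symm (e₂ n).symm).map (Pi.evalRingHom (fun w' : PlacesOver E v => w'.1.adicCompletion E) w) - 1 := by
    intro g
    ext i j
    by_cases hij : i = j
    · subst hij
      simp
    · have hij' : (e₂ n).symm i ≠ (e₂ n).symm j := fun h => hij ((e₂ n).symm.injective h)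
      simp [hij, hij']
  refine ⟨⟨fun i j => ?_, fun i j => ?_⟩, fun i j => ?_, fun i j => ?_⟩
  · rw [e]; exact hk _ _
  · rw [hinv, e]; exact hk' _ _
  · rw [e, ← hsub1]; exact hk1 _ _
  · rw [hinv, e, ← hsub1]; exact hk1' _ _

end Component

/-! ## §4 HEAD: deep unipotents are deep -/

section Head

variable {w : PlacesOver E v}

omit [NumberField F] [Algebra.IsQuadraticExtension F E] in
/-- `(−t)_w` has the same bound as `t_w`. [folklore] -/
theorem valBound_map_neg {γ : ValuativeRel.ValueGroupWithZero (w.1.adicCompletion E)} {t : Matrix (Fin n) (Fin n) (LocalRing E v)}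
    (htγ : ValBound γ (t.map (Pi.evalRingHom (fun w' : PlacesOver E v => w'.1.adicCompletion E) w))) :
    ValBound γ ((-t).map (Pi.evalRingHom (fun w' : PlacesOver E v => w'.1.adicCompletion E) w)) := by
  rw [Matrix.map_neg _ (map_neg _)]
  exact htγ.neg

omit [Algebra.IsQuadraticExtension F E] in
include hJD in
/-- **DEEP UNIPOTENTS ARE DEEP.**  GR91 local frame at a place `v` with `|2|_w = 1` at the place `w ∣ v`; `t` a `T₀`-skew block over `E ⊗ F_v` whose `w`-entries satisfy
`valuation (t i j)_w ≤ γ` for some `γ ≤ 1`.  THEN the `w`-component of the unipotent `n(t) ∈ N_Δ(F_v)` (★ `nElem`) lies in the principal congruence subgroup `congruenceGL (n+n) γ`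
of `GL_{n+n}(E_w)`: `matA (n(±t)) − 1 = R·[[0, ±t],[0,0]]·R⁻¹` (§2), `n(t)⁻¹ = n(−t)` (★ `nElem_inv`), integrality ★ `isIntegralAt_matA_nElem`.
[cite: PlatonovRapinchuk1994, §5.1] [cite: Casselman1980, §3] [cite: GelbartRogawski1991, §3.1 (3.1.3)] -/
theorem nElem_apply_mem_congruenceGL (h2 : ValuativeRel.valuation (w.1.adicCompletion E) (2 : w.1.adicCompletion E) = 1)
    {t : Matrix (Fin n) (Fin n) (LocalRing E v)} (ht : (t.map (conjLocal E c v))ᵀ * gramS F E v n T₀ + gramS F E v n T₀ * t = 0)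
    {γ : ValuativeRel.ValueGroupWithZero (w.1.adicCompletion E)} (hγ : γ ≤ 1)
    (htγ : ValBound γ (t.map (Pi.evalRingHom (fun w' : PlacesOver E v => w'.1.adicCompletion E) w))) :
    (nElem F E c v n hJD t ht : UnitaryGroup.LocalGLPi E (n + n) v) w ∈ congruenceGL (n + n) γ := by
  have hti : IsIntegralAt F E v w t := fun i j => (htγ i j).trans hγ
  have hti' : IsIntegralAt F E v w (-t) := hti.neg
  refine apply_mem_congruenceGL_of_valBound F E c v n (nElem F E c v n hJD t ht) γ
    (isIntegralAt_matA_nElem F E c v n hJD w h2 ht hti) ?_ (valBound_matA_nElem_sub_one F E c v n hJD h2 ht htγ) ?_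
  · rw [nElem_inv]
    exact isIntegralAt_matA_nElem F E c v n hJD w h2 _ hti'
  · rw [nElem_inv]
    exact valBound_matA_nElem_sub_one F E c v n hJD h2 _ (valBound_map_neg F E v n htγ)

omit [Algebra.IsQuadraticExtension F E] in
include hJD in
/-- **THE UNIFORMIZER READING** — `(n(t))_w ∈ K_w(ϖ_w^M) = congruenceGL (n+n) (valuation ϖ_w ^ M)` when every `w`-entry of `t` has `valuation ≤ valuation ϖ_w ^ M`
(`|ϖ_w| < 1`, so `γ = valuation ϖ_w ^ M ≤ 1`) — the currency of ★ (c1) `conj_mem_congruenceGL_of_localHeight_le` and 📤 (ρ5) `exists_finset_forall_evalAt_mem_congruenceGL_imp_mem`.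
[cite: PlatonovRapinchuk1994, §5.1] [cite: Casselman1980, §3] -/
theorem nElem_apply_mem_congruenceGL_pow (h2 : ValuativeRel.valuation (w.1.adicCompletion E) (2 : w.1.adicCompletion E) = 1)
    {t : Matrix (Fin n) (Fin n) (LocalRing E v)} (ht : (t.map (conjLocal E c v))ᵀ * gramS F E v n T₀ + gramS F E v n T₀ * t = 0)
    {ϖ : w.1.adicCompletion E} (hϖ : ValuativeRel.valuation (w.1.adicCompletion E) ϖ ≤ 1) (M : ℕ)
    (htM : ∀ i j, ValuativeRel.valuation (w.1.adicCompletion E) (t i j w) ≤ ValuativeRel.valuation (w.1.adicCompletion E) ϖ ^ M) :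
    (nElem F E c v n hJD t ht : UnitaryGroup.LocalGLPi E (n + n) v) w ∈ congruenceGL (n + n) (ValuativeRel.valuation (w.1.adicCompletion E) ϖ ^ M) :=
  nElem_apply_mem_congruenceGL F E c v n hJD h2 ht (pow_le_one' hϖ M) fun i j => htM i j

end Head

/-! ## §5 EVERY place, dyadic included: `|t_w| ≤ |2|_w · γ` ⟹ `(n(t))_w ∈ congruenceGL (n+n) γ` -/

section Dyadic

variable {w : PlacesOver E v}

omit [Algebra.IsQuadraticExtension F E] in
/-- **the `w`-entries of `R⁻¹ = ½R` have valuation `≤ |2|_w⁻¹`** (`R` is `w`-integral, ★ `isIntegralAt_cayR`; `(⅟2)_w · 2 = 1`). [cite: HarrisKudlaSweet1996, §1 (1.11)] -/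
theorem valBound_cayRinv :
    ValBound (ValuativeRel.valuation (w.1.adicCompletion E) (2 : w.1.adicCompletion E))⁻¹
      ((cayRinv (LocalRing E v) (Fin n)).map (Pi.evalRingHom (fun w' : PlacesOver E v => w'.1.adicCompletion E) w)) := by
  intro i j
  have hR := isIntegralAt_cayR F E v n w i j
  have h : (⅟(2 : LocalRing E v)) w * 2 = 1 := by
    have := congrFun (invOf_mul_self (2 : LocalRing E v)) w
    simpa using this
  have h2 : ValuativeRel.valuation (w.1.adicCompletion E) ((⅟(2 : LocalRing E v)) w) =
      (ValuativeRel.valuation (w.1.adicCompletion E) (2 : w.1.adicCompletion E))⁻¹ := by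
    have := congrArg (ValuativeRel.valuation (w.1.adicCompletion E)) h
    rw [_root_.map_mul, _root_.map_one] at this
    exact eq_inv_of_mul_eq_one_left this
  rw [cayRinv]
  simp only [Matrix.map_apply, Matrix.smul_apply, smul_eq_mul, Pi.evalRingHom_apply, _root_.map_mul, h2] at hR ⊢
  exact mul_le_of_le_one_right' hR

omit [Algebra.IsQuadraticExtension F E] in
include hJD in
/-- **THE `w`-ENTRIES OF `matA (n(t)) − 1` ARE `≤ γ` WHEN THOSE OF `t` ARE `≤ |2|_w · γ`** — at EVERY place: `matA (n(t)) − 1 = R · [[0,t],[0,0]] · R⁻¹` with `R` integral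
and `|R⁻¹| ≤ |2|_w⁻¹` (no `|2|_w = 1` needed; at a dyadic `w` the test block is taken `|2|_w`-deeper). [cite: HarrisKudlaSweet1996, §1 (1.11)] [cite: PlatonovRapinchuk1994, §5.1] -/
theorem valBound_matA_nElem_sub_one_of_two {t : Matrix (Fin n) (Fin n) (LocalRing E v)}
    (ht : (t.map (conjLocal E c v))ᵀ * gramS F E v n T₀ + gramS F E v n T₀ * t = 0) {γ : ValuativeRel.ValueGroupWithZero (w.1.adicCompletion E)}
    (htγ : ValBound (ValuativeRel.valuation (w.1.adicCompletion E) (2 : w.1.adicCompletion E) * γ)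
      (t.map (Pi.evalRingHom (fun w' : PlacesOver E v => w'.1.adicCompletion E) w))) :
    ValBound γ ((matA F E c v n (nElem F E c v n hJD t ht) - 1).map (Pi.evalRingHom (fun w' : PlacesOver E v => w'.1.adicCompletion E) w)) := by
  rw [matA_nElem_sub_one F E c v n hJD ht]
  have hR : ValBound 1 ((cayR (LocalRing E v) (Fin n)).map (Pi.evalRingHom (fun w' : PlacesOver E v => w'.1.adicCompletion E) w)) :=
    isIntegralAt_cayR F E v n w
  have h := valBound_map_mul (valBound_map_mul hR (valBound_fromBlocks_zero F E v n htγ)) (valBound_cayRinv F E v n (w := w))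
  have h2 : ValuativeRel.valuation (w.1.adicCompletion E) (2 : w.1.adicCompletion E) ≠ 0 :=
    (Valuation.ne_zero_iff _).2 two_ne_zero
  rwa [one_mul, mul_comm (ValuativeRel.valuation (w.1.adicCompletion E) 2) γ, mul_inv_cancel_right₀ h2] at h

omit [NumberField F] [Algebra.IsQuadraticExtension F E] in
/-- a matrix congruent to `1` within `γ ≤ 1` at `w` is `w`-integral (entrywise `M = (M − 1) + 1`, ★ `IsIntegralAt.one`). [cite: PlatonovRapinchuk1994, §5.1] -/
theorem isIntegralAt_of_valBound_sub_one {m : Type*} [Fintype m] [DecidableEq m] {M : Matrix m m (LocalRing E v)}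
    {γ : ValuativeRel.ValueGroupWithZero (w.1.adicCompletion E)} (hγ : γ ≤ 1)
    (h : ValBound γ ((M - 1).map (Pi.evalRingHom (fun w' : PlacesOver E v => w'.1.adicCompletion E) w))) : IsIntegralAt F E v w M := by
  intro i j
  rw [Matrix.map_apply, ← sub_add_cancel (M i j) ((1 : Matrix m m (LocalRing E v)) i j), _root_.map_add]
  refine Valuation.map_add_le _ ?_ ?_
  · have h1 := h i j
    rw [Matrix.map_apply, Matrix.sub_apply] at h1
    exact h1.trans hγ
  · have h1 := IsIntegralAt.one (F := F) (E := E) (v := v) (w := w) (m := m) i j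
    rw [Matrix.map_apply] at h1
    exact h1

omit [Algebra.IsQuadraticExtension F E] in
include hJD in
/-- **DEEP UNIPOTENTS ARE DEEP, AT EVERY PLACE.**  `t` a `T₀`-skew block over `E ⊗ F_v` whose `w`-entries satisfy `valuation (t i j)_w ≤ |2|_w · γ`, `γ ≤ 1`; THEN
`(n(t))_w ∈ congruenceGL (n+n) γ` — as §4 `nElem_apply_mem_congruenceGL` but WITHOUT `|2|_w = 1`: integrality of `matA (n(±t))` now comes from `matA (n(±t)) − 1 ≡ 0 (γ)`
(`isIntegralAt_of_valBound_sub_one`), and `n(t)⁻¹ = n(−t)` (★ `nElem_inv`). [cite: PlatonovRapinchuk1994, §5.1] [cite: Casselman1980, §3] [cite: HarrisKudlaSweet1996, §1 (1.11)] -/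
theorem nElem_apply_mem_congruenceGL_of_two {t : Matrix (Fin n) (Fin n) (LocalRing E v)}
    (ht : (t.map (conjLocal E c v))ᵀ * gramS F E v n T₀ + gramS F E v n T₀ * t = 0)
    {γ : ValuativeRel.ValueGroupWithZero (w.1.adicCompletion E)} (hγ : γ ≤ 1)
    (htγ : ValBound (ValuativeRel.valuation (w.1.adicCompletion E) (2 : w.1.adicCompletion E) * γ)
      (t.map (Pi.evalRingHom (fun w' : PlacesOver E v => w'.1.adicCompletion E) w))) :
    (nElem F E c v n hJD t ht : UnitaryGroup.LocalGLPi E (n + n) v) w ∈ congruenceGL (n + n) γ := by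
  have h1 := valBound_matA_nElem_sub_one_of_two F E c v n hJD ht htγ
  have htγ' : ValBound (ValuativeRel.valuation (w.1.adicCompletion E) (2 : w.1.adicCompletion E) * γ)
      ((-t).map (Pi.evalRingHom (fun w' : PlacesOver E v => w'.1.adicCompletion E) w)) := valBound_map_neg F E v n htγ
  have h1' : ValBound γ ((matA F E c v n (nElem F E c v n hJD t ht)⁻¹ - 1).map (Pi.evalRingHom (fun w' : PlacesOver E v => w'.1.adicCompletion E) w)) := by
    rw [nElem_inv]
    exact valBound_matA_nElem_sub_one_of_two F E c v n hJD _ htγ'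
  exact apply_mem_congruenceGL_of_valBound F E c v n (nElem F E c v n hJD t ht) γ (isIntegralAt_of_valBound_sub_one F E v hγ h1)
    (isIntegralAt_of_valBound_sub_one F E v hγ h1') h1 h1'

omit [Algebra.IsQuadraticExtension F E] in
include hJD in
/-- **THE UNIFORMIZER READING AT EVERY PLACE** — `(n(t))_w ∈ congruenceGL (n+n) (valuation ϖ_w ^ M)` when every `w`-entry of `t` has `valuation ≤ |2|_w · valuation ϖ_w ^ M`
(`|ϖ_w| ≤ 1`); the currency of ★ (c1) and ★ (ρ5), dyadic places included. [cite: PlatonovRapinchuk1994, §5.1] [cite: Casselman1980, §3] -/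
theorem nElem_apply_mem_congruenceGL_pow_of_two {t : Matrix (Fin n) (Fin n) (LocalRing E v)}
    (ht : (t.map (conjLocal E c v))ᵀ * gramS F E v n T₀ + gramS F E v n T₀ * t = 0)
    {ϖ : w.1.adicCompletion E} (hϖ : ValuativeRel.valuation (w.1.adicCompletion E) ϖ ≤ 1) (M : ℕ)
    (htM : ∀ i j, ValuativeRel.valuation (w.1.adicCompletion E) (t i j w) ≤
      ValuativeRel.valuation (w.1.adicCompletion E) (2 : w.1.adicCompletion E) * ValuativeRel.valuation (w.1.adicCompletion E) ϖ ^ M) :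
    (nElem F E c v n hJD t ht : UnitaryGroup.LocalGLPi E (n + n) v) w ∈ congruenceGL (n + n) (ValuativeRel.valuation (w.1.adicCompletion E) ϖ ^ M) :=
  nElem_apply_mem_congruenceGL_of_two F E c v n hJD ht (pow_le_one' hϖ M) fun i j => htM i j

end Dyadic

end Summit.HodgeConjecture.HodgeConjecture.Cruxes.HLiu418.K2LiuUnipotentDeepLevel

end
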